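import Literature.Computability.QuantumComplexity.FKMachineTable
import HarnessLib

/-!
# A polynomial-time verifier for Fellows–Koblitz certificates: lines and certificates

Continuation of `FKMachineTable.lean` (`FKMachine.tableTestFn`, `FKMachine.encLine`,
`FKMachine.encNats`), machine side of `NumberTheory/Primality/FellowsKoblitzCertificates.lean`
(`FK.LineValid`, `FK.CertValid`, `FK.heads`), in the style of `PrattMachine.lean`. In the
sub-namespace `FKMachine`:

* reading and writing certificates: `lineOf`, `linesOf` (total decoders), `encLines`, with
  `lineOf_encLine`, `linesOf_encLines`, `mem_heads_linesOf_iff`;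
* the **finite table of small primes**: `memConstFn l w = [w ∈ l]` is in `FP` for every finite list
  `l` of strings (`memConstFn_mem_FP`, by induction — `l` is never evaluated), instantiated with the
  codes of the primes below `2^1023` (`isSmallPrimeFn`, `isSmallPrimeFn_encodeNat`): heads with fewer
  than `1024` binary digits are certified by table look-up, which is what makes the threshold of the
  Fellows–Koblitz test harmless;
* `smallCaseFn`, `bigCaseFn`, **`lineTestFn`** (one line against the certificate: small head in the
  table with no data, or large head with nondecreasing `qs`, `∏ qs = p − 1`, every `q` a head, and the
  table test), **`certTestFn`** (all lines); each in `FP`, one-bit, with the truth lemmas on genuine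
  codes **`lineTestFn_encLine_eq_true_iff`** (`↔ FK.LineValid (FK.heads ls) l`) and
  **`certTestFn_encLines_eq_true_iff`** (`↔ FK.CertValid ls`).

## References

* M. R. Fellows, N. Koblitz, *Self-witnessing polynomial-time complexity and prime factorization*,
  Designs, Codes and Cryptography 2 (1992) 231–235, Lemma 1, Theorem 1 (proof).
* S. Arora, B. Barak, *Computational Complexity: A Modern Approach*, CUP 2009, §1.3.
-/

namespace Literature.Computability.QuantumComplexity

namespace FKMachine

open _root_.Computability Complexity Complexity.Classes Complexity.Brick Complexity.HashBricks Complexity.Plumb Polynomial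
open Literature.NumberTheory.Primality
open PrattMachine (allFn_eq_true_iff memHeadFn_eq_true_iff eqValFn_eq_true_iff ltFn_eq_true_iff)

/-! ### Reading and writing certificates -/

/-- The line denoted by a string `it = ⟨p, ⟨qs, T⟩⟩` (total). [folklore] -/
def lineOf (it : List Bool) : FK.Line :=
  (bitsToNat (fstF it), (decNil (nthF 1 it)).map bitsToNat, (decNil (sndPow 1 it)).map bitsToNat)

/-- The certificate denoted by a string (total). [folklore] -/
def linesOf (Ls : List Bool) : List FK.Line := (decNil Ls).map lineOf

/-- The code of a certificate: the coded list of the codes of its lines. [folklore] -/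
def encLines (ls : List FK.Line) : List Bool := encList (ls.map encLine)

/-- Reading back a written line. [folklore] -/
@[simp] theorem lineOf_encLine (l : FK.Line) : lineOf (encLine l) = l := by
  obtain ⟨p, qs, T⟩ := l
  simp [lineOf, encLine, nthF, sndPow, Function.comp_def]

/-- Reading back a written certificate. [folklore] -/
@[simp] theorem linesOf_encLines (ls : List FK.Line) : linesOf (encLines ls) = ls := by
  simp [linesOf, encLines, List.map_map, Function.comp_def]

/-- `decNil` of a written certificate. [folklore] -/
@[simp] theorem decNil_encLines (ls : List FK.Line) : decNil (encLines ls) = ls.map encLine := by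
  simp [encLines]

/-- The head field of a written line. [folklore] -/
@[simp] theorem fstF_encLine (l : FK.Line) : fstF (encLine l) = encodeNat l.1 := by
  simp [encLine]

/-- The `qs` field of a written line. [folklore] -/
@[simp] theorem nthF_one_encLine (l : FK.Line) : nthF 1 (encLine l) = encNats l.2.1 := by
  simp [encLine, nthF]

/-- The table field of a written line. [folklore] -/
@[simp] theorem sndPow_one_encLine (l : FK.Line) : sndPow 1 (encLine l) = encNats l.2.2 := by
  simp [encLine, sndPow]

/-- The heads available in a coded certificate are the values of the first fields of its items.
[folklore] -/
theorem mem_heads_linesOf_iff (Ls : List Bool) (v : ℕ) :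
    v ∈ FK.heads (linesOf Ls) ↔ ∃ item ∈ decNil Ls, bitsToNat (fstF item) = v := by
  simp only [FK.heads, linesOf, Set.mem_setOf_eq, List.mem_map]
  constructor
  · rintro ⟨l, ⟨it, hit, rfl⟩, hl⟩
    exact ⟨it, hit, hl⟩
  · rintro ⟨it, hit, hv⟩
    exact ⟨lineOf it, ⟨it, hit, rfl⟩, hv⟩

/-- The heads of a written certificate. [folklore] -/
theorem mem_heads_linesOf_encLines_iff (ls : List FK.Line) (v : ℕ) :
    (∃ item ∈ decNil (encLines ls), bitsToNat (fstF item) = v) ↔ v ∈ FK.heads ls := by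
  rw [← mem_heads_linesOf_iff, linesOf_encLines]

/-- `encNats` is empty only for the empty list. [folklore] -/
theorem encNats_eq_nil_iff (ns : List ℕ) : encNats ns = [] ↔ ns = [] := by
  cases ns with
  | nil => simp [encNats]
  | cons n ns =>
    simp only [encNats, List.map_cons, encList_cons, reduceCtorEq, iff_false]
    intro h
    have := congrArg List.length h
    simp at this

/-! ### The finite table of small primes -/

/-- **Membership in a fixed finite list of strings**: `memConstFn l w = [w ∈ l]`. [folklore] -/
def memConstFn (l : List (List Bool)) (w : List Bool) : List Bool := [decide (w ∈ l)]

/-- `memConstFn l` is one-bit. [folklore] -/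
theorem oneBit_memConstFn (l : List (List Bool)) : OneBit (memConstFn l) := fun _ => ⟨_, rfl⟩

/-- **`memConstFn l ∈ FP`** for every finite list `l` (a disjunction of `|l|` string comparisons with
constants; by induction on `l`, which is never evaluated). [cite: AroraBarakCC2009, §1.3] -/
theorem memConstFn_mem_FP : ∀ l : List (List Bool), memConstFn l ∈ FP
  | [] => by
    have : memConstFn [] = fun _ => [false] := funext fun w => by simp [memConstFn]
    rw [this]; exact const_mem_FP _
  | c :: l => by
    have h : memConstFn (c :: l) = orFn (eqPairFn ∘ fanoutFn id (fun _ => c)) (memConstFn l) := by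
      funext w
      have h1 : (eqPairFn ∘ fanoutFn id (fun _ => c)) w = [decide (w = c)] := by simp [eqPairFn_boolPair]
      rw [orFn_apply h1 (rfl : memConstFn l w = [decide (w ∈ l)])]
      simp [memConstFn]
    rw [h]
    exact orFn_mem_FP (comp_mem_FP eqPairFn_mem_FP (fanoutFn_mem_FP (PolyTimeComputable.id _) (const_mem_FP _)))
      (memConstFn_mem_FP l)

/-- The primes with fewer than `1024` binary digits (a finite list; never evaluated).
[cite: FellowsKoblitz1992, Lemma 1 (Remark: an effective `p₀`)] -/
def smallPrimes : List ℕ := (List.range (2 ^ 1023)).filter fun n => decide n.Prime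

/-- Membership in `smallPrimes`: prime with `size < 1024`. [folklore] -/
theorem mem_smallPrimes_iff (n : ℕ) : n ∈ smallPrimes ↔ n.size < 1024 ∧ n.Prime := by
  unfold smallPrimes
  -- (no `simp` here: the literal power must not be evaluated)
  rw [List.mem_filter, List.mem_range, decide_eq_true_eq, ← Nat.size_le]
  constructor <;> rintro ⟨h1, h2⟩ <;> exact ⟨by omega, h2⟩

/-- **The table look-up** `isSmallPrimeFn w = [w is the canonical numeral of a small prime]`.
[cite: FellowsKoblitz1992, Lemma 1 (Remark: an effective `p₀`)] -/
def isSmallPrimeFn : List Bool → List Bool := memConstFn (smallPrimes.map encodeNat)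

/-- `isSmallPrimeFn ∈ FP`. [cite: AroraBarakCC2009, §1.3] -/
theorem isSmallPrimeFn_mem_FP : isSmallPrimeFn ∈ FP := memConstFn_mem_FP _

/-- `isSmallPrimeFn` is one-bit. [folklore] -/
theorem oneBit_isSmallPrimeFn : OneBit isSmallPrimeFn := oneBit_memConstFn _

/-- **Truth of the table look-up on a canonical numeral.** [folklore] -/
theorem isSmallPrimeFn_encodeNat (n : ℕ) : isSmallPrimeFn (encodeNat n) = [true] ↔ n.size < 1024 ∧ n.Prime := by
  simp only [isSmallPrimeFn, memConstFn, List.cons.injEq, and_true, decide_eq_true_eq, List.mem_map]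
  constructor
  · rintro ⟨m, hm, hmn⟩
    rw [encodeNat_inj] at hmn
    subst hmn
    exact (mem_smallPrimes_iff m).1 hm
  · intro h
    exact ⟨n, (mem_smallPrimes_iff n).2 h, rfl⟩

/-! ### The line test -/

/-- Context projections of the line test on `⟨Ls, it⟩`, `it = ⟨p, ⟨qs, T⟩⟩`: the head field. [folklore] -/
noncomputable def lP : List Bool → List Bool := fstF ∘ sndF
/-- The `qs` field. [folklore] -/
noncomputable def lQS : List Bool → List Bool := nthF 1 ∘ sndF
/-- The table field. [folklore] -/
noncomputable def lT : List Bool → List Bool := sndPow 1 ∘ sndF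

/-- **The small case**: the head is in the table of small primes and the line carries no data.
[cite: FellowsKoblitz1992, Lemma 1 (Remark: an effective `p₀`)] -/
noncomputable def smallCaseFn : List Bool → List Bool :=
  andFn (isSmallPrimeFn ∘ lP) (andFn (isNilFn ∘ lQS) (isNilFn ∘ lT))

/-- `smallCaseFn ∈ FP`. [folklore] -/
theorem smallCaseFn_mem_FP : smallCaseFn ∈ FP :=
  andFn_mem_FP (comp_mem_FP isSmallPrimeFn_mem_FP (comp_mem_FP fstF_mem_FP sndF_mem_FP))
    (andFn_mem_FP (comp_mem_FP isNilFn_mem_FP (comp_mem_FP (nthF_mem_FP 1) sndF_mem_FP))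
      (comp_mem_FP isNilFn_mem_FP (comp_mem_FP (sndPow_mem_FP 1) sndF_mem_FP)))

/-- `smallCaseFn` is one-bit. [folklore] -/
theorem oneBit_smallCaseFn : OneBit smallCaseFn :=
  oneBit_andFn (oneBit_isSmallPrimeFn.comp _) (oneBit_andFn (oneBit_isNilFn.comp _) (oneBit_isNilFn.comp _))

/-- Truth of the small case on the code of a line. [folklore] -/
theorem smallCaseFn_eq_true_iff (Ls : List Bool) (l : FK.Line) :
    smallCaseFn (boolPair Ls (encLine l)) = [true] ↔ l.1.size < 1024 ∧ l.1.Prime ∧ l.2.1 = [] ∧ l.2.2 = [] := by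
  rw [smallCaseFn, PrattMachine.andFn_eq_true_iff (oneBit_isSmallPrimeFn.comp _) (oneBit_andFn (oneBit_isNilFn.comp _) (oneBit_isNilFn.comp _)),
    PrattMachine.andFn_eq_true_iff (oneBit_isNilFn.comp _) (oneBit_isNilFn.comp _)]
  simp only [Function.comp_apply, lP, lQS, lT, sndF_boolPair, fstF_encLine, nthF_one_encLine, sndPow_one_encLine,
    isSmallPrimeFn_encodeNat, isNilFn, List.cons.injEq, and_true, decide_eq_true_eq, encNats_eq_nil_iff, and_assoc]

/-- The comparison `⟦a⟧ ≤ ⟦b⟧` of consecutive items `⟨x, ⟨a, b⟩⟩` (for `chainFn`). [folklore] -/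
noncomputable def leItemsFn : List Bool → List Bool := notFn (ltFn ∘ fanoutFn (sndF ∘ sndF) (fstF ∘ sndF))

/-- `leItemsFn ∈ FP`. [folklore] -/
theorem leItemsFn_mem_FP : leItemsFn ∈ FP :=
  notFn_mem_FP (comp_mem_FP ltFn_mem_FP (fanoutFn_mem_FP (comp_mem_FP sndF_mem_FP sndF_mem_FP) (comp_mem_FP fstF_mem_FP sndF_mem_FP)))

/-- `leItemsFn` is one-bit. [folklore] -/
theorem oneBit_leItemsFn : OneBit leItemsFn := oneBit_notFn (oneBit_ltFn.comp _)

/-- Truth of `leItemsFn`. [folklore] -/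
theorem leItemsFn_eq_true_iff (x a b : List Bool) :
    leItemsFn (boolPair x (boolPair a b)) = [true] ↔ bitsToNat a ≤ bitsToNat b := by
  rw [leItemsFn, PrattMachine.notFn_eq_true_iff (oneBit_ltFn.comp _)]
  simp [not_lt]

/-- The head-membership test of an item `q` against the certificate, on `⟨⟨Ls, p⟩, q⟩`. [folklore] -/
noncomputable def qHeadFn : List Bool → List Bool := memHeadFn ∘ fanoutFn sndF (fstF ∘ fstF)

/-- `qHeadFn ∈ FP`. [folklore] -/
theorem qHeadFn_mem_FP : qHeadFn ∈ FP :=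
  comp_mem_FP memHeadFn_mem_FP (fanoutFn_mem_FP sndF_mem_FP (comp_mem_FP fstF_mem_FP fstF_mem_FP))

/-- `qHeadFn` is one-bit. [folklore] -/
theorem oneBit_qHeadFn : OneBit qHeadFn := oneBit_memHeadFn.comp _

/-- Truth of `qHeadFn`. [folklore] -/
theorem qHeadFn_eq_true_iff (Ls p q : List Bool) :
    qHeadFn (boolPair (boolPair Ls p) q) = [true] ↔ ∃ item ∈ decNil Ls, bitsToNat (fstF item) = bitsToNat q := by
  simp [qHeadFn, memHeadFn_eq_true_iff]

/-- **The big case**: at least `1024` binary digits, `qs` nondecreasing with `∏ qs = ⟦p⟧ − 1`, every `q`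
a head of the certificate, and the table test. [cite: FellowsKoblitz1992, Lemma 1] -/
noncomputable def bigCaseFn : List Bool → List Bool :=
  andFn (notFn (ltLenF ∘ fanoutFn lP (fun _ => ones 1024)))
    (andFn (chainFn leItemsFn ∘ fanoutFn (fun _ => []) lQS)
      (andFn (eqValFn ∘ fanoutFn (prodListFn ∘ fanoutFn (fun _ => []) lQS) (subFn ∘ fanoutFn lP (fun _ => [true])))
        (andFn (allFn qHeadFn ∘ fanoutFn (fanoutFn fstF lP) lQS) (tableTestFn ∘ sndF))))

/-- `bigCaseFn ∈ FP`. [cite: AroraBarakCC2009, §1.3] -/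
theorem bigCaseFn_mem_FP : bigCaseFn ∈ FP := by
  have hP : lP ∈ FP := comp_mem_FP fstF_mem_FP sndF_mem_FP
  have hQS : lQS ∈ FP := comp_mem_FP (nthF_mem_FP 1) sndF_mem_FP
  exact andFn_mem_FP (notFn_mem_FP (comp_mem_FP ltLenF_mem_FP (fanoutFn_mem_FP hP (const_mem_FP _))))
    (andFn_mem_FP (comp_mem_FP (chainFn_mem_FP leItemsFn_mem_FP oneBit_leItemsFn) (fanoutFn_mem_FP (const_mem_FP _) hQS))
      (andFn_mem_FP (comp_mem_FP eqValFn_mem_FP (fanoutFn_mem_FP (comp_mem_FP prodListFn_mem_FP (fanoutFn_mem_FP (const_mem_FP _) hQS))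
          (comp_mem_FP subFn_mem_FP (fanoutFn_mem_FP hP (const_mem_FP _)))))
        (andFn_mem_FP (comp_mem_FP (allFn_mem_FP qHeadFn_mem_FP oneBit_qHeadFn) (fanoutFn_mem_FP (fanoutFn_mem_FP fstF_mem_FP hP) hQS))
          (comp_mem_FP tableTestFn_mem_FP sndF_mem_FP))))

/-- `bigCaseFn` is one-bit. [folklore] -/
theorem oneBit_bigCaseFn : OneBit bigCaseFn :=
  oneBit_andFn (oneBit_notFn (oneBit_ltLenF.comp _)) (oneBit_andFn ((oneBit_chainFn _).comp _)
    (oneBit_andFn (oneBit_eqValFn.comp _) (oneBit_andFn ((oneBit_allFn oneBit_qHeadFn).comp _) (oneBit_tableTestFn.comp _))))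

/-- Truth of the big case on genuine codes. [cite: FellowsKoblitz1992, Lemma 1] -/
theorem bigCaseFn_eq_true_iff (ls : List FK.Line) (l : FK.Line) :
    bigCaseFn (boolPair (encLines ls) (encLine l)) = [true] ↔
      1024 ≤ l.1.size ∧ List.IsChain (· ≤ ·) l.2.1 ∧ l.2.1.prod = l.1 - 1 ∧ (∀ q ∈ l.2.1, q ∈ FK.heads ls) ∧
        FK.TableOK l.1 l.2.1 l.2.2 ∧ l.1 ≤ FK.lcmList l.2.2 ^ 2 := by
  rw [bigCaseFn, PrattMachine.andFn_eq_true_iff (oneBit_notFn (oneBit_ltLenF.comp _)) (oneBit_andFn ((oneBit_chainFn _).comp _)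
      (oneBit_andFn (oneBit_eqValFn.comp _) (oneBit_andFn ((oneBit_allFn oneBit_qHeadFn).comp _) (oneBit_tableTestFn.comp _)))),
    PrattMachine.andFn_eq_true_iff ((oneBit_chainFn _).comp _)
      (oneBit_andFn (oneBit_eqValFn.comp _) (oneBit_andFn ((oneBit_allFn oneBit_qHeadFn).comp _) (oneBit_tableTestFn.comp _))),
    PrattMachine.andFn_eq_true_iff (oneBit_eqValFn.comp _) (oneBit_andFn ((oneBit_allFn oneBit_qHeadFn).comp _) (oneBit_tableTestFn.comp _)),
    PrattMachine.andFn_eq_true_iff ((oneBit_allFn oneBit_qHeadFn).comp _) (oneBit_tableTestFn.comp _),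
    PrattMachine.notFn_eq_true_iff (oneBit_ltLenF.comp _)]
  obtain ⟨p, qs, T⟩ := l
  simp only [Function.comp_apply, fanoutFn_apply, lP, lQS, fstF_boolPair, sndF_boolPair, fstF_encLine, nthF_one_encLine,
    ltLenF_boolPair, TM2Pass.length_encodeNat_eq_size, List.length_replicate, List.cons.injEq, and_true, decide_eq_true_eq,
    not_lt, encNats, chainFn_encList_eq_true oneBit_leItemsFn, leItemsFn_eq_true_iff, List.isChain_map, bitsToNat_encodeNat,
    eqValFn_eq_true_iff, prodListFn_boolPair, subFn_boolPair, bitsToNat_true, allFn_eq_true_iff oneBit_qHeadFn,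
    qHeadFn_eq_true_iff, mem_heads_linesOf_encLines_iff, decNil_encList, List.forall_mem_map, List.map_map,
    map_bitsToNat_comp_encodeNat]
  constructor
  · rintro ⟨hsz, hch, hpr, hH, hT⟩
    have h2 : 2 ≤ p := le_trans (by norm_num) (Nat.lt_size.1 (show 1 < p.size by omega))
    exact ⟨hsz, hch, hpr, hH, (tableTestFn_encLine_eq_true_iff h2 qs T).1 hT⟩
  · rintro ⟨hsz, hch, hpr, hH, hT⟩
    have h2 : 2 ≤ p := le_trans (by norm_num) (Nat.lt_size.1 (show 1 < p.size by omega))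
    exact ⟨hsz, hch, hpr, hH, (tableTestFn_encLine_eq_true_iff h2 qs T).2 hT⟩

/-- **The line test** `lineTestFn ⟨Ls, it⟩`: small case or big case. [cite: FellowsKoblitz1992, Lemma 1] -/
noncomputable def lineTestFn : List Bool → List Bool := orFn smallCaseFn bigCaseFn

/-- `lineTestFn ∈ FP`. [cite: AroraBarakCC2009, §1.3] -/
theorem lineTestFn_mem_FP : lineTestFn ∈ FP := orFn_mem_FP smallCaseFn_mem_FP bigCaseFn_mem_FP

/-- `lineTestFn` is one-bit. [folklore] -/
theorem oneBit_lineTestFn : OneBit lineTestFn := oneBit_orFn oneBit_smallCaseFn oneBit_bigCaseFn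

/-- **Truth of the line test on genuine codes**: validity of the line with respect to the heads of
the certificate. [cite: FellowsKoblitz1992, Lemma 1] -/
theorem lineTestFn_encLine_eq_true_iff (ls : List FK.Line) (l : FK.Line) :
    lineTestFn (boolPair (encLines ls) (encLine l)) = [true] ↔ FK.LineValid (FK.heads ls) l := by
  rw [lineTestFn, PrattMachine.orFn_eq_true_iff oneBit_smallCaseFn oneBit_bigCaseFn, smallCaseFn_eq_true_iff,
    bigCaseFn_eq_true_iff]
  rfl

/-! ### The certificate test -/

/-- **The certificate test** `certTestFn Ls`: every item of `Ls` passes the line test against `Ls`.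
[cite: FellowsKoblitz1992, Theorem 1 (proof)] -/
noncomputable def certTestFn : List Bool → List Bool := allFn lineTestFn ∘ fanoutFn id id

/-- `certTestFn ∈ FP`. [cite: AroraBarakCC2009, §1.3] -/
theorem certTestFn_mem_FP : certTestFn ∈ FP :=
  comp_mem_FP (allFn_mem_FP lineTestFn_mem_FP oneBit_lineTestFn) (fanoutFn_mem_FP (PolyTimeComputable.id _) (PolyTimeComputable.id _))

/-- `certTestFn` is one-bit. [folklore] -/
theorem oneBit_certTestFn : OneBit certTestFn := (oneBit_allFn oneBit_lineTestFn).comp _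

/-- **Truth of the certificate test on a genuine code**: the certificate is valid.
[cite: FellowsKoblitz1992, Theorem 1 (proof)] -/
theorem certTestFn_encLines_eq_true_iff (ls : List FK.Line) : certTestFn (encLines ls) = [true] ↔ FK.CertValid ls := by
  rw [certTestFn, Function.comp_apply, fanoutFn_apply, id, allFn_eq_true_iff oneBit_lineTestFn]
  simp only [decNil_encLines, List.forall_mem_map, lineTestFn_encLine_eq_true_iff, FK.CertValid]

end FKMachine

end Literature.Computability.QuantumComplexity
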